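import Literature.Barriers.AnomalousDissipation.ShearFlowViscositySelectionAssembly
import Literature.Analysis.FluidPDE.NSUniqueness2HalfD
import HarnessLib

/-!
# Bardos–Titi–Wiedemann 2012, Theorem 5 — the discharge

Theorem-only. The weak–strong uniqueness theorem of Bardos–Lopes Filho–Niu–Nussenzveig
Lopes–Titi 2013 (Thm. 3.1 and Rem. 3.1) is proved in the tree on `T³` as
`Literature.Analysis.FluidPDE.Torus.lerayHopf_ae_eq_of_invariant_datum`
(`Analysis/FluidPDE/NSUniqueness2HalfD`): any two Leray–Hopf weak solutions of the unforced
Navier–Stokes equations with the same weakly divergence-free `L²` datum invariant under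
translations along the third axis agree a.e. on every time slice. The shear datum
`v₀ = (v₁(x₂), 0, v₃(x₁,x₂))` is such a datum (`memLp_shearData`, `isWeaklyDivFree_shearData`,
`shearData_add_single_two`, `ShearFlowViscositySelectionSteps`), so the named fact
`BardosTitiWiedemann2012_thm5_uniqueness` holds, and the reduction
`BardosTitiWiedemann2012_thm5_of_uniqueness` (`ShearFlowViscositySelectionAssembly`, which
combines the tree's discharges of the two-and-a-half-dimensional Leray–Hopf structure, the
heat-flow limit of the first component, the limit transport equation and Lemma 4) turns the
named fact `BardosTitiWiedemann2012_thm5` (`ShearFlowViscositySelection`) into a theorem.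

* `BardosTitiWiedemann2012_thm5_holds` — Thm. 5 of op. cit.: for shear data with
  `v₁ ∈ L²(T)`, `v₃ ∈ L²(T²)` and every `ν > 0` there is a Leray–Hopf solution of the
  Navier–Stokes equations on `T³`, unique among all Leray–Hopf solutions, and
  `u^ν ⇀* (v₁(x₂), 0, v₃(x₁ - t v₁(x₂), x₂))` in `L^∞([0,T]; L²(T³))` as `ν → 0`.

## References

* C. Bardos, E. S. Titi, E. Wiedemann, *The vanishing viscosity as a selection principle for the
  Euler equations: the case of 3D shear flow*, C. R. Math. Acad. Sci. Paris 350 (2012) 757–760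
  = arXiv:1208.2352, Thm. 5 and its proof (`BardosTitiWiedemann2012`).
* C. Bardos, M. C. Lopes Filho, D. Niu, H. J. Nussenzveig Lopes, E. S. Titi, *Stability of
  two-dimensional viscous incompressible flows under three-dimensional perturbations and
  inviscid symmetry breaking*, SIAM J. Math. Anal. 45 (2013) 1871–1885, Thm. 3.1, Rem. 3.1
  (`BardosEtAl2013`).
-/

open MeasureTheory

noncomputable section

namespace Literature.Barriers.AnomalousDissipation

/-- **Bardos–Titi–Wiedemann 2012, Thm. 5, proved.** The vanishing viscosity limit selects the
shear flow: discharge of the named fact `BardosTitiWiedemann2012_thm5`. The uniqueness input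
("this solution is unique within the class of all 3D Leray-Hopf weak solutions", op. cit., proof
of Thm. 5, referring to Bardos et al. 2013) is the tree's weak–strong uniqueness theorem for
`x₃`-independent data `Torus.lerayHopf_ae_eq_of_invariant_datum`, applied to the shear datum;
everything else is `BardosTitiWiedemann2012_thm5_of_uniqueness`. [cite: BardosTitiWiedemann2012, Thm. 5] [cite: BardosEtAl2013, Thm. 3.1 and Rem. 3.1] -/
theorem BardosTitiWiedemann2012_thm5_holds : BardosTitiWiedemann2012_thm5 :=
  BardosTitiWiedemann2012_thm5_of_uniqueness fun _v₁ hv₁ _v₃ hv₃ _T hT _ν hν _u _u' hu hu' =>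
    Literature.Analysis.FluidPDE.Torus.lerayHopf_ae_eq_of_invariant_datum hν hT
      (memLp_shearData hv₁ hv₃) (isWeaklyDivFree_shearData hv₁ hv₃)
      (shearData_add_single_two _ _) hu hu'

end Literature.Barriers.AnomalousDissipation

end
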